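import Summits.KontsevichZagierPeriods.KontsevichZagierPeriods.Theorems.RootDecompRationalCubeDichotomyNashMultiGenP14

/-! # `RootDecompRationalCubeDichotomyNashMultiGenP15` — part 15/16 of the mechanical ≤385-line split of `NashEtaleMultiGen.lean`
(split by the decomp-kz census seat for landing; mathematics unchanged; part 15 continues part 14). -/

open Set MvPolynomial Filter Topology
open Literature.NumberTheory.Transcendental (IsSemialgebraicFunOn)
open Literature.ModelTheory.ExponentialFields (IsSemialgebraic isSemialgebraic_setOf_eval_pos
  isSemialgebraic_setOf_eval_ne_zero)

namespace Summit.KontsevichZagierPeriods.RootDecompRationalCubeDichotomy.Rung29430.MultiGen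
open Summit.KontsevichZagierPeriods.KontsevichZagierPeriods.Theses.RootDecompRationalCubeDichotomy
  (NashEtaleCover NashEtaleLocal PiRationalisation)
open Summit.KontsevichZagierPeriods.RootDecompRationalCubeDichotomy.Rung29430.NashEtaleLocalGlue
  (local_of_simple nashEtaleCover_of_nashEtaleLocal nashEtaleLocal_zero)
open Summit.KontsevichZagierPeriods.RootDecompRationalCubeDichotomy.Rung29430.NashEtaleLocalOne
  (analyticOnNhd_aeval_snoc)
open Summit.KontsevichZagierPeriods.RootDecompRationalCubeDichotomy.RungEtale.Etale
  (piRationalisation_of_nashEtaleCover)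

noncomputable section

section SpecialGeTwo
open Literature.NumberTheory.Transcendental Literature.ModelTheory.ExponentialFields

end SpecialGeTwo

/-! ### §7  Toolkit for the RAMIFIED one-variable case over `K` (towards `SliceNash 1`, NODE.md §6)

Quantifier elimination over ANY coefficient ring is in the tree (the kit of
`Literature/NumberTheory/Transcendental/SemialgebraicDerivativeProofs.lean`); here: (K1) the
derivative of a `K`-semialgebraic function is `K`-semialgebraic, (K2) `dslope` at the `K`-point `0`
and its iterates are `K`-semialgebraic, the exact Taylor formula, and (L) the division lemma. -/
section OriginOneKit

open Literature.NumberTheory.Transcendental Literature.ModelTheory.ExponentialFields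
open Literature.NumberTheory.Transcendental.SemialgebraicDerivative
open Function

variable {K : Type} [CommRing K] [Algebra K ℝ]

/-- Polynomial atom `= 0` (any predicate pointwise equivalent to it). -/
theorem sa_eqz {N : ℕ} (p : MvPolynomial (Fin N) K) {P : (Fin N → ℝ) → Prop}
    (h : ∀ z, P z ↔ MvPolynomial.aeval z p = 0) : IsSemialgebraic K {z : Fin N → ℝ | P z} := by
  rw [show {z : Fin N → ℝ | P z} = {z | MvPolynomial.aeval z p = 0} from Set.ext fun z => h z]
  exact isSemialgebraic_setOf_eval_eq_zero p

/-- Polynomial atom `≠ 0`. -/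
theorem sa_nez {N : ℕ} (p : MvPolynomial (Fin N) K) {P : (Fin N → ℝ) → Prop}
    (h : ∀ z, P z ↔ MvPolynomial.aeval z p ≠ 0) : IsSemialgebraic K {z : Fin N → ℝ | P z} := by
  rw [show {z : Fin N → ℝ | P z} = {z | MvPolynomial.aeval z p ≠ 0} from Set.ext fun z => h z]
  exact isSemialgebraic_setOf_eval_ne_zero p

/-- **(K1) The derivative of a `K`-semialgebraic function of one variable is `K`-semialgebraic**
(Basu–Pollack–Roy Prop. 3.22 over the coefficient ring `K`: the tree's proof of
`IsSemialgebraicFunOn.hasDerivAt_isSemialgebraic_holds`, verbatim with `ℚ → K`). -/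
theorem hasDerivAt_isSemialgebraicK {a b : ℝ} {f f' : ℝ → ℝ}
    (hf : IsSemialgebraicFunOn K {t : Fin 1 → ℝ | t 0 ∈ Set.Ioo a b} (fun t => f (t 0)))
    (hd : ∀ x ∈ Set.Ioo a b, HasDerivAt f (f' x) x) :
    IsSemialgebraicFunOn K {t : Fin 1 → ℝ | t 0 ∈ Set.Ioo a b} (fun t => f' (t 0)) := by
  rw [isSemialgebraicFunOn_iff] at hf ⊢
  have hG : IsSemialgebraic K {w : Fin 2 → ℝ | w 0 ∈ Ioo a b ∧ w 1 = f (w 0)} := hf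
  suffices key : IsSemialgebraic K {z : Fin 2 → ℝ |
      (∃ u : ℝ, z 0 ∈ Ioo a b ∧ u = f (z 0)) ∧
      ∀ ε : ℝ, 0 < ε → ∃ δ : ℝ, 0 < δ ∧ ∀ s u v : ℝ,
        (s ∈ Ioo a b ∧ u = f s) → (z 0 ∈ Ioo a b ∧ v = f (z 0)) → s ≠ z 0 →
        (s - z 0) ^ 2 < δ ^ 2 → (u - v - z 1 * (s - z 0)) ^ 2 < ε ^ 2 * (s - z 0) ^ 2} by
    convert key using 1
    refine Set.ext fun z => ?_
    change (z 0 ∈ Ioo a b ∧ z 1 = f' (z 0)) ↔ _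
    simp only [mem_setOf_eq]
    constructor
    · rintro ⟨hx, hy⟩
      refine ⟨⟨f (z 0), hx, rfl⟩, fun ε hε => ?_⟩
      have hder : HasDerivAt f (z 1) (z 0) := by
        rw [hy]
        exact hd (z 0) hx
      obtain ⟨δ, hδ, hεδ⟩ := (hasDerivAt_iff_forall_mem (Ioo_mem_nhds hx.1 hx.2)).1 hder ε hε
      refine ⟨δ, hδ, fun s u v hu hv hst hsδ => ?_⟩
      obtain ⟨hs, rfl⟩ := hu
      obtain ⟨-, rfl⟩ := hv
      exact hεδ s hs hst hsδ
    · rintro ⟨⟨-, hx, -⟩, hΦ⟩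
      refine ⟨hx, HasDerivAt.unique ?_ (hd (z 0) hx)⟩
      refine (hasDerivAt_iff_forall_mem (Ioo_mem_nhds hx.1 hx.2)).2 fun ε hε => ?_
      obtain ⟨δ, hδ, h⟩ := hΦ ε hε
      exact ⟨δ, hδ, fun s hsI hst hsδ => h s (f s) (f (z 0)) ⟨hsI, rfl⟩ ⟨hx, rfl⟩ hst hsδ⟩
  refine sa_and (sa_exists (sa_graph₀ hG _ _)) ?_
  refine sa_forall (sa_imp (sa_pos _) (sa_exists (sa_and (sa_pos _) ?_)))
  refine sa_forall (sa_forall (sa_forall ?_))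
  exact sa_imp (sa_graph₀ hG _ _) (sa_imp (sa_graph₀ hG _ _)
    (sa_imp (sa_ne _ _) (sa_imp (sa_sq_sub_lt_sq _ _ _) (sa_taylor _ _ _ _ _ _))))

/-- **(K2) `dslope` at the `K`-point `0` of a `K`-semialgebraic differentiable function is
`K`-semialgebraic** (g7's `isSemialgebraicFunOn_dslope_of_isAlgebraic` at the centre `0`; the
constant `f 0` is presented as `∃ x, (x, u) ∈ Γ_f ∧ x = 0`, so no algebraicity of `f 0` is needed). -/
theorem isSemialgebraicFunOn_dslope_zeroK {a b : ℝ} {f f' : ℝ → ℝ} (h0 : (0:ℝ) ∈ Set.Ioo a b)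
    (hf : IsSemialgebraicFunOn K {t : Fin 1 → ℝ | t 0 ∈ Set.Ioo a b} (fun t => f (t 0)))
    (hd : ∀ x ∈ Set.Ioo a b, HasDerivAt f (f' x) x) :
    IsSemialgebraicFunOn K {t : Fin 1 → ℝ | t 0 ∈ Set.Ioo a b} (fun t => dslope f 0 (t 0)) := by
  have hf' := hasDerivAt_isSemialgebraicK hf hd
  rw [isSemialgebraicFunOn_iff] at hf hf' ⊢
  have hG : IsSemialgebraic K {w : Fin 2 → ℝ | w 0 ∈ Ioo a b ∧ w 1 = f (w 0)} := hf
  have hG' : IsSemialgebraic K {w : Fin 2 → ℝ | w 0 ∈ Ioo a b ∧ w 1 = f' (w 0)} := hf'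
  suffices key : IsSemialgebraic K {w : Fin 2 → ℝ |
      (w 0 ≠ 0 ∧ ∃ v u : ℝ, (w 0 ∈ Ioo a b ∧ v = f (w 0)) ∧
        (∃ x : ℝ, (x ∈ Ioo a b ∧ u = f x) ∧ x = 0) ∧ w 1 * w 0 - (v - u) = 0) ∨
      (w 0 = 0 ∧ (w 0 ∈ Ioo a b ∧ w 1 = f' (w 0)))} by
    convert key using 1
    refine Set.ext fun w => ?_
    change (w 0 ∈ Ioo a b ∧ w 1 = dslope f 0 (w 0)) ↔ _
    simp only [mem_setOf_eq]
    by_cases hw : w 0 = 0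
    · have hds : dslope f 0 (w 0) = f' (w 0) := by
        rw [hw, dslope_same]
        exact (hd 0 h0).deriv
      rw [hds]
      constructor
      · rintro ⟨hI, h1⟩
        exact Or.inr ⟨hw, hI, h1⟩
      · rintro (⟨hne, -⟩ | ⟨-, hI, h1⟩)
        · exact absurd hw hne
        · exact ⟨hI, h1⟩
    · have hds : dslope f 0 (w 0) = (f (w 0) - f 0) / (w 0 - 0) := by
        rw [dslope_of_ne _ hw, slope_def_field]
      rw [hds, sub_zero]
      constructor
      · rintro ⟨hI, h1⟩
        refine Or.inl ⟨hw, f (w 0), f 0, ⟨hI, rfl⟩, ⟨0, ⟨h0, rfl⟩, rfl⟩, ?_⟩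
        rw [h1, div_mul_cancel₀ _ hw, sub_self]
      · rintro (⟨-, v, u, ⟨hI, rfl⟩, ⟨x, ⟨-, rfl⟩, rfl⟩, h⟩ | ⟨h0', -⟩)
        · exact ⟨hI, by rw [eq_div_iff hw]; exact (sub_eq_zero.mp h)⟩
        · exact absurd h0' hw
  refine IsSemialgebraic.union (sa_and (sa_nez (X 0) fun z => by simp) ?_)
    (sa_and (sa_eqz (X 0) fun z => by simp) (sa_graph₀ hG' 0 1))
  refine sa_exists (sa_exists (sa_and (sa_graph₀ hG _ _) (sa_and
    (sa_exists (sa_and (sa_graph₀ hG _ _) (sa_eqz (X (Fin.last 4)) fun z => by simp))) ?_)))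
  exact sa_eqz (X (Fin.castSucc (Fin.castSucc 1)) * X (Fin.castSucc (Fin.castSucc 0)) -
      (X (Fin.castSucc (Fin.last 2)) - X (Fin.last 3))) fun z => by simp [Fin.init]

/-- Iterated `dslope`s at `0` of a function analytic on an interval `∋ 0` are analytic there (g7). -/
theorem analyticAt_iterate_dslope_zero {a b : ℝ} {f : ℝ → ℝ} (h0 : (0:ℝ) ∈ Set.Ioo a b)
    (hf : ∀ x ∈ Set.Ioo a b, AnalyticAt ℝ f x) (k : ℕ) :
    ∀ x ∈ Set.Ioo a b, AnalyticAt ℝ ((swap dslope (0:ℝ))^[k] f) x := by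
  induction k with
  | zero => simpa using hf
  | succ k ih =>
    intro x hx
    rw [Function.iterate_succ_apply']
    exact analyticAt_dslope_of_analyticAt (ih 0 h0) (ih x hx)

/-- **(K2′) Iterated `dslope`s at `0` of a `K`-Nash function of one variable are `K`-semialgebraic.** -/
theorem isSemialgebraicFunOn_iterate_dslope_zeroK {a b : ℝ} {f : ℝ → ℝ} (h0 : (0:ℝ) ∈ Set.Ioo a b)
    (hf : IsSemialgebraicFunOn K {t : Fin 1 → ℝ | t 0 ∈ Set.Ioo a b} (fun t => f (t 0)))
    (han : ∀ x ∈ Set.Ioo a b, AnalyticAt ℝ f x) (k : ℕ) :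
    IsSemialgebraicFunOn K {t : Fin 1 → ℝ | t 0 ∈ Set.Ioo a b}
      (fun t => (swap dslope (0:ℝ))^[k] f (t 0)) := by
  induction k with
  | zero => simpa using hf
  | succ k ih =>
    have h := isSemialgebraicFunOn_dslope_zeroK (f := (swap dslope (0:ℝ))^[k] f)
      (f' := deriv ((swap dslope (0:ℝ))^[k] f)) h0 ih
      (fun x hx => ((analyticAt_iterate_dslope_zero h0 han k x hx).differentiableAt).hasDerivAt)
    simpa [Function.iterate_succ_apply'] using h

/-- **Exact Taylor formula with `dslope` remainder** at `0` (g7):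
`f t = Σ_{k<n} u_k(0) t^k + t^n u_n(t)`, `u_k = (swap dslope 0)^[k] f`. -/
theorem taylor_iterate_dslope_zero (f : ℝ → ℝ) (n : ℕ) (t : ℝ) :
    f t = ∑ k ∈ Finset.range n, (swap dslope (0:ℝ))^[k] f 0 * t ^ k +
      t ^ n * (swap dslope (0:ℝ))^[n] f t := by
  induction n with
  | zero => simp
  | succ n ih =>
    rw [Finset.sum_range_succ, ih, Function.iterate_succ_apply']
    have h := sub_smul_dslope ((swap dslope (0:ℝ))^[n] f) 0 t
    rw [smul_eq_mul, sub_zero] at h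
    have h' : (swap dslope (0:ℝ))^[n] f t =
        (swap dslope (0:ℝ))^[n] f 0 + t * dslope ((swap dslope (0:ℝ))^[n] f) 0 t := by
      rw [h]; ring
    rw [h', pow_succ]
    simp only [Function.swap]
    ring

/-- **(L) Division lemma**: a real polynomial which near `0` equals `t ^ e · h t` with `h`
continuous at `0` is divisible by `X ^ e`. -/
theorem X_pow_dvd_of_eventually_eq {e : ℕ} :
    ∀ {q : Polynomial ℝ} {h : ℝ → ℝ}, ContinuousAt h 0 →
      (∀ᶠ t in 𝓝 (0:ℝ), q.eval t = t ^ e * h t) → Polynomial.X ^ e ∣ q := by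
  induction e with
  | zero => intros; simp
  | succ e ih =>
    intro q h hh hq
    have hq0 : q.eval 0 = 0 := by
      have := hq.self_of_nhds
      simpa using this
    obtain ⟨q₁, rfl⟩ : Polynomial.X ∣ q := by
      rw [Polynomial.X_dvd_iff, Polynomial.coeff_zero_eq_eval_zero]
      exact hq0
    -- `q₁ t = t ^ e * h t` on a punctured neighbourhood of `0`
    have hne : ∀ᶠ t in 𝓝[≠] (0:ℝ), q₁.eval t = t ^ e * h t := by
      filter_upwards [hq.filter_mono nhdsWithin_le_nhds, self_mem_nhdsWithin] with t ht htne
      rw [Polynomial.eval_mul, Polynomial.eval_X] at ht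
      have : t * q₁.eval t = t * (t ^ e * h t) := by rw [ht]; ring
      exact mul_left_cancel₀ htne this
    -- … and at `0` by continuity
    have hc1 : Tendsto (fun t => q₁.eval t) (𝓝[≠] (0:ℝ)) (𝓝 (q₁.eval 0)) :=
      q₁.continuous.continuousAt.tendsto.mono_left nhdsWithin_le_nhds
    have hc2 : Tendsto (fun t => t ^ e * h t) (𝓝[≠] (0:ℝ)) (𝓝 ((0:ℝ) ^ e * h 0)) :=
      (((continuous_pow e).continuousAt).mul hh).tendsto.mono_left nhdsWithin_le_nhds
    have hat0 : q₁.eval 0 = (0:ℝ) ^ e * h 0 := tendsto_nhds_unique (hc1.congr' hne) hc2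
    have hq₁ : ∀ᶠ t in 𝓝 (0:ℝ), q₁.eval t = t ^ e * h t := by
      rw [← nhdsNE_sup_pure, Filter.eventually_sup, Filter.eventually_pure]
      exact ⟨hne, hat0⟩
    rw [pow_succ']
    exact mul_dvd_mul_left _ (ih hh hq₁)

/-- Polynomial functions over `K` are continuous. -/
theorem continuous_aevalK {N : ℕ} (p : MvPolynomial (Fin N) K) :
    Continuous fun x : Fin N → ℝ => MvPolynomial.aeval x p := by
  have h : (fun x : Fin N → ℝ => MvPolynomial.aeval x p) =
      fun x => MvPolynomial.eval x (MvPolynomial.map (algebraMap K ℝ) p) := by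
    funext x
    rw [MvPolynomial.eval_map, MvPolynomial.aeval_def]
  rw [h]
  exact MvPolynomial.continuous_eval _

/-- **Generic points of the line over `K`.**  If every `K`-polynomial vanishing at `x ∈ ℝ¹`
vanishes identically, then every `K`-semialgebraic subset of `ℝ¹` is a neighbourhood of `x` or of
its complement (the tree's `nhds_or_compl_mem_nhds_of_transcendental`, `ℚ → K`). -/
theorem nhds_or_compl_mem_nhds_of_genericK {x : Fin 1 → ℝ}
    (hx : ∀ p : MvPolynomial (Fin 1) K, MvPolynomial.aeval x p = 0 →
      ∀ y : Fin 1 → ℝ, MvPolynomial.aeval y p = 0)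
    {s : Set (Fin 1 → ℝ)} (hs : IsSemialgebraic K s) : s ∈ 𝓝 x ∨ sᶜ ∈ 𝓝 x := by
  induction hs using BooleanSubalgebra.closure_bot_sup_induction with
  | mem t ht =>
    rcases ht with ⟨p, rfl⟩ | ⟨p, rfl⟩
    · by_cases hp : MvPolynomial.aeval x p = 0
      · left
        exact Filter.univ_mem' fun y => hx p hp y
      · right
        have hopen : IsOpen {y : Fin 1 → ℝ | MvPolynomial.aeval y p ≠ 0} :=
          isOpen_ne_fun (continuous_aevalK p) continuous_const
        have hmem : {y : Fin 1 → ℝ | MvPolynomial.aeval y p ≠ 0} ∈ 𝓝 x := hopen.mem_nhds hp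
        simpa [Set.compl_setOf] using hmem
    · by_cases hp : MvPolynomial.aeval x p = 0
      · right
        refine Filter.univ_mem' fun y => ?_
        simp only [Set.mem_compl_iff, Set.mem_setOf_eq, hx p hp y, lt_self_iff_false,
          not_false_eq_true]
      · rcases lt_or_gt_of_ne hp with hlt | hgt
        · right
          have hopen : IsOpen {y : Fin 1 → ℝ | MvPolynomial.aeval y p < 0} :=
            isOpen_lt (continuous_aevalK p) continuous_const
          filter_upwards [hopen.mem_nhds hlt] with y hy
          simp only [Set.mem_compl_iff, Set.mem_setOf_eq, not_lt]
          exact le_of_lt hy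
        · left
          exact (isOpen_lt continuous_const (continuous_aevalK p)).mem_nhds hgt
  | bot =>
    right
    simp
  | sup t _ u _ iht ihu =>
    rcases iht with ht | ht
    · exact Or.inl (Filter.mem_of_superset ht Set.subset_union_left)
    · rcases ihu with hu | hu
      · exact Or.inl (Filter.mem_of_superset hu Set.subset_union_right)
      · right
        have h : (t ⊔ u)ᶜ = tᶜ ∩ uᶜ := by
          show (t ∪ u)ᶜ = tᶜ ∩ uᶜ
          exact Set.compl_union t u
        rw [h]
        exact Filter.inter_mem ht hu
  | compl t _ iht =>
    rcases iht with ht | ht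
    · right
      simpa only [compl_compl] using ht
    · exact Or.inl ht

/-- A `K`-semialgebraic function of one variable takes at the `K`-point `0` a value which is a
root of a `K`-polynomial not vanishing identically on `ℝ`. -/
theorem exists_root_apply_zeroK {a b : ℝ} {u : ℝ → ℝ} (h0 : (0:ℝ) ∈ Set.Ioo a b)
    (hu : IsSemialgebraicFunOn K {t : Fin 1 → ℝ | t 0 ∈ Set.Ioo a b} (fun t => u (t 0))) :
    ∃ p : MvPolynomial (Fin 1) K, MvPolynomial.aeval (fun _ : Fin 1 => u 0) p = 0 ∧
      ∃ y : Fin 1 → ℝ, MvPolynomial.aeval y p ≠ 0 := by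
  rw [isSemialgebraicFunOn_iff] at hu
  have hG : IsSemialgebraic K {w : Fin 2 → ℝ | w 0 ∈ Ioo a b ∧ w 1 = u (w 0)} := hu
  -- the slice `{y | y 0 = u 0}` of the graph at the `K`-point `0`
  have hS : IsSemialgebraic K {y : Fin 1 → ℝ | ∃ t : ℝ, (t ∈ Ioo a b ∧ y 0 = u t) ∧ t = 0} :=
    sa_exists (sa_and (sa_graph₀ hG _ _) (sa_eqz (X (Fin.last 1)) fun z => by simp))
  have hSeq : {y : Fin 1 → ℝ | ∃ t : ℝ, (t ∈ Ioo a b ∧ y 0 = u t) ∧ t = 0} =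
      {y : Fin 1 → ℝ | y 0 = u 0} := by
    ext y
    simp only [Set.mem_setOf_eq]
    constructor
    · rintro ⟨t, ⟨-, h⟩, rfl⟩
      exact h
    · intro h
      exact ⟨0, ⟨h0, h⟩, rfl⟩
  rw [hSeq] at hS
  by_contra hne
  push Not at hne
  have hgen : ∀ p : MvPolynomial (Fin 1) K, MvPolynomial.aeval (fun _ : Fin 1 => u 0) p = 0 →
      ∀ y : Fin 1 → ℝ, MvPolynomial.aeval y p = 0 := hne
  rcases nhds_or_compl_mem_nhds_of_genericK hgen hS with h | h
  · obtain ⟨ε, hε, hball⟩ := Metric.mem_nhds_iff.mp h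
    have hy : (fun _ : Fin 1 => u 0 + ε / 2) ∈ Metric.ball (fun _ : Fin 1 => u 0) ε := by
      rw [Metric.mem_ball, dist_pi_const, Real.dist_eq, add_sub_cancel_left, abs_of_pos (by linarith)]
      linarith
    have := hball hy
    simp only [Set.mem_setOf_eq] at this
    linarith
  · have := mem_of_mem_nhds h
    simp at this

/-- **(K3) Values at the `K`-point `0` of `K`-semialgebraic functions are SIMPLE roots of
`K`-polynomials**: `∃ M ∈ K[z]` with `M(c) = 0`, `M'(c) ≠ 0` (`c = u 0`; `M` = a suitable iterated
derivative of the polynomial of `exists_root_apply_zeroK`). -/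
theorem exists_simpleRoot_apply_zeroK {a b : ℝ} {u : ℝ → ℝ} (h0 : (0:ℝ) ∈ Set.Ioo a b)
    (hu : IsSemialgebraicFunOn K {t : Fin 1 → ℝ | t 0 ∈ Set.Ioo a b} (fun t => u (t 0))) :
    ∃ M : Polynomial K, Polynomial.aeval (u 0) M = 0 ∧
      Polynomial.aeval (u 0) (Polynomial.derivative M) ≠ 0 := by
  obtain ⟨p, hp0, y, hy⟩ := exists_root_apply_zeroK h0 hu
  -- pass to one-variable polynomials: `P₁ := p(X)`, `Q := P₁` over `ℝ`
  let P₁ : Polynomial K := MvPolynomial.aeval (fun _ : Fin 1 => (Polynomial.X : Polynomial K)) p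
  have hP₁ : ∀ c : ℝ, Polynomial.aeval c P₁ = MvPolynomial.aeval (fun _ : Fin 1 => c) p := by
    intro c
    have h : (Polynomial.aeval c : Polynomial K →ₐ[K] ℝ).comp
        (MvPolynomial.aeval fun _ : Fin 1 => (Polynomial.X : Polynomial K)) =
        MvPolynomial.aeval (fun _ : Fin 1 => c) :=
      MvPolynomial.algHom_ext fun i => by simp
    exact DFunLike.congr_fun h p
  let Q : Polynomial ℝ := P₁.map (algebraMap K ℝ)
  have hQ : ∀ c : ℝ, Q.eval c = MvPolynomial.aeval (fun _ : Fin 1 => c) p := by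
    intro c
    rw [Polynomial.eval_map, ← Polynomial.aeval_def, hP₁]
  have hQne : Q ≠ 0 := by
    intro hQ0
    apply hy
    have : MvPolynomial.aeval (fun _ : Fin 1 => y 0) p = 0 := by rw [← hQ, hQ0, Polynomial.eval_zero]
    have hyy : y = fun _ : Fin 1 => y 0 := by
      funext i
      rw [Subsingleton.elim i 0]
    rw [hyy]
    exact this
  have hQ0 : Q.eval (u 0) = 0 := by rw [hQ]; exact hp0
  -- root multiplicity `r ≥ 1`; `M := P₁^{(r-1)}`
  set r := Q.rootMultiplicity (u 0) with hr
  have hrpos : 0 < r := (Polynomial.rootMultiplicity_pos hQne).mpr hQ0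
  refine ⟨Polynomial.derivative^[r - 1] P₁, ?_, ?_⟩
  · have h1 : (Polynomial.derivative^[r - 1] Q).IsRoot (u 0) :=
      Polynomial.isRoot_iterate_derivative_of_lt_rootMultiplicity (by omega)
    rw [Polynomial.aeval_def, ← Polynomial.eval_map, ← Polynomial.iterate_derivative_map]
    exact h1
  · have h2 := Polynomial.eval_iterate_derivative_rootMultiplicity (p := Q) (t := u 0)
    have h3 := Polynomial.eval_divByMonic_pow_rootMultiplicity_ne_zero (u 0) hQne
    rw [Polynomial.aeval_def, ← Polynomial.eval_map, ← Polynomial.derivative_map,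
      ← Polynomial.iterate_derivative_map, ← Function.iterate_succ_apply' Polynomial.derivative,
      show (r - 1).succ = r by omega]
    change (Polynomial.derivative^[r] Q).eval (u 0) ≠ 0
    rw [← hr] at h2
    rw [h2, nsmul_eq_mul]
    exact mul_ne_zero (by exact_mod_cast (Nat.factorial_pos r).ne') h3

end OriginOneKit
end
end Summit.KontsevichZagierPeriods.RootDecompRationalCubeDichotomy.Rung29430.MultiGen
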